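import Summits.BirchSwinnertonDyer.BirchSwinnertonDyer.Theses.PrintX11a
import Summits.BirchSwinnertonDyer.BirchSwinnertonDyer.Theorems.PrintX11aUpperNonSurjFiveDepthStrata
import Summits.BirchSwinnertonDyer.BirchSwinnertonDyer.Theorems.PrintX11aUpperNonSurjFiveShallowSector
import Summits.BirchSwinnertonDyer.BirchSwinnertonDyer.Theorems.PrintX11aUpperNonSurjFiveOfNineFacts
import Summits.BirchSwinnertonDyer.BirchSwinnertonDyer.Theorems.ErratumRoadFiveNonSurjCornerTwinTateParameterPow
import Summits.BirchSwinnertonDyer.Rank1Residual.Additive.PlusSymbolIntegrality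
import Literature.NumberTheory.EllipticCurves.PAdicLFunctionMultiplicativeInterpolation
import Literature.NumberTheory.EllipticCurves.PAdicLFunctionIntegralityOddMultProofs
import Literature.NumberTheory.EllipticCurves.CanonicalPAdicHeightIntegralityProofs
import Literature.NumberTheory.EllipticCurves.PAdicHeightsTateValuationProofs
import Literature.NumberTheory.EllipticCurves.PAdicHeightsLogProofs
import Literature.NumberTheory.EllipticCurves.PAdicHeightsProofs
import Literature.NumberTheory.EllipticCurves.PAdicBSDSplitMultiplicativeProofs
import HarnessLib

/-!
# Line «mudichot5» for crux U5 = `PrintX11a.UpperNonSurjFive` (item `stmt-BirchSwinnertonDyer-20614`)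

bsd-idea-6 g16, lens «decomp», CRUX-LEVEL ONLY (D-0152 ∕ W-71; W-79 publish-only: this file is PUBLISHED with `ledger crux write`, never
`skeleton check`ed — the line of record is «gl1cartan5» rev 12 (`stub_printFacts`, `stub_shaExponentCore` = C_Ш, `stub_tamagawaDepthCore` = C_cc);
it is the rule-(4) successor of «gsdepth5», whose instrument «w = 1» REF g24 found VACUOUS on U5).  BSD is not proved by any of this; the crux
does NOT close (three `sorry`s, all inside `stub_*`).

## Idea (one paragraph)

THE μ-DICHOTOMY AT MINIMAL TATE DEPTH.  Diagnosis of «gsdepth5» (REF g24, kernel: `TatePow.TateParameterData.exists_pow_eq_q_of_irr_of_not_surj`): on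
X11a with `ρ̄_{E,p}` NOT onto and `p` split multiplicative the Tate period is a `p`-th power, `q_E = r^p`, so `log_p q_E = p · log_p r` and the Tate depth
`w := ord_p log_p q_E` is `≥ 2` at EVERY pair of U5 (`norm_padicLog_q_le` below; REF's p710098 `two_le_valuation_padicLog_q_of_irr_of_not_surj`) — the Greenberg–Stevens budget
`ord_p (L(E,1)/Ω_E) = ord_p [T¹]L_p + 1 + v_p(c_p) − w` (`[T¹]L_p · log_p γ = ℒ · [0]⁺_f`, `ℒ = log_p q / ord_p q`, `c_p = ord_p q = v_p Δ`) therefore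
needs ONE MORE `p` in the linear coefficient `a₁ = [T¹]L_p` than «gsdepth5» budgeted, at the minimal depth `w = 2` (generic: the unit part of `r` is
non-Wieferich; REF's engine: `w₅ = 2` at 20 of the 23 split census pairs, `w₅ = 3` at 3).  The lever that supplies it is a DICHOTOMY on Greenberg's `μ`:
EITHER some Néron-normalised Mazur–Tate–Teitelbaum function `ϖ·L_p(E,T)` has a unit coefficient (`μ_an = 0` AT THE PAIR) — then Kato's divisibility is
integral at the pair and the tree's μ-door `ClassX11a.missingUpperBoundAt_of_not_surj_of_hardCert_of_nineFacts` gives `ord_p #Ш ≤ ord_p #Ш_an` outright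
(nine facts + GS) —, OR none has (`MuExceptionalAt W p`: `μ_an ≥ 1`, the negation of the door's certificate) — then `p ∣ a₁` FOR FREE (`‖a₁‖ ≤ 1` by MTT
integrality at irreducible `E[p]`, `‖ϖ‖_p = 1` by Mazur, and «no unit coefficient»), and the GS budget at `w = 2` returns `ord_p (L(E,1)/Ω_E) ≥ v_p(c_p)`,
which is what BSD asks when `p` is the only carrier and `Ш(E)[p] = 0`.  BOTH BRANCHES CLOSE the sector
A″ = «`p` split, `w = 2`, `ord_p ∏c ≤ v_p(c_p)`, `Ш(E)[p] = 0`» class-wide modulo the prints — new beyond the record exactly on its stratum T1@p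
(`p² ∣ c_p`; depth `≤ 1` is the record's EXC-SHALLOW) — and the open part of U5 becomes the record's two cores RESTRICTED TO THE μ-EXCEPTIONAL BRANCH
(`stub_shaExponentCoreMuExc` = C_Ш ∩ {μ_an ≥ 1}, `stub_tamagawaDepthCoreMuExc` = (C_cc ∖ A″) ∩ {μ_an ≥ 1}), a branch that is CONJECTURALLY EMPTY —
Greenberg's Conj. 1.11 (ALGEBRAIC μ: `E[p]` irreducible ⇒ μ_alg = 0) PLUS the main-conjecture equality μ_an = μ_alg, which is NOT known exactly
at a non-surjective `p` (Kato's divisibility carries a `p`-power ambiguity there); `MuExceptionalAt` below is μ_an ≥ 1 (idea-crit-10 V#159 R2) —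
and on which every computed pair of the census is known NOT to lie (μ-certificates, `PrintX11aHardLocusRecords*`, `PrintX11aMuCosetRecords*`).
HONEST CEILING (first-order): at `w = 2` every mod-`p` statement about `a₁` (μ, Greenberg–Vatsal transport, Kato mod `p`) is worth exactly the one `p`
that BSD spends on `w − 1 = 1`; the census strata T2 (two carriers) and C_Ш need `a₁ mod p²`, which no residual congruence supplies — they stay in the stubs.

## REV 2 (inhabitation; critic method BC2-(i) after V#158) — THE CLASS-WIDE VALUATION THEOREM AT MINIMAL DEPTH

`pDepthAtP_le_padicValRat_LOne_div_of_minimalDepth` (real proof, both branches, CONDITIONAL on the prints): for minimal `E/ℚ` in X11a with `ρ̄_{E,p}`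
not onto, `5 ≤ p`, `p` SPLIT multiplicative and Tate depth `w = 2`:  **`ord_p (L(E,1)/Ω_E) ≥ v_p(c_p) = v_p(v_p(Δ_min))`** — no `Ш` hypothesis, no
Tamagawa hypothesis (μ-branch: the budget; certificate branch: the μ-door's `ord_p #Ш ≤ ord_p #Ш_an` read back through `ord_p #Ш_an = ord_p(L/Ω) − ord_p ∏c`
and the fact-free `v_p(c_p) ≤ ord_p ∏c`, `pDepthAtP_le_padicValNat_tamagawaProduct_of_split`).  Its antecedent is INHABITED BY NAME: the 20 split census
pairs with `w₅ = 2` of REF g24's ENGINE R (job:j327971 on `RecordsLeafNonSurjN500000Part1/2`: 6480d1, 25920q1, 51840l1, 51840m1, 56180e1, 64980bg1,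
64980g1, 74060i1, 84960a1, 92480eh1, 154880bb1, 154880bg1, 184960ck1, 184960l1, 224720j1, 259920ec1, 259920hc1, 346560fq1, 346560lh1, 389205n1), and it is
SHARP at 6480d1 (record `RecordsLeafNonSurjN500000Part1`: `c₅ = v₅(Δ_min) = 5`, `∏c = 5`, `L(E,1)/Ω_E = 5`, `#Ш_an = 1`, image `5S4`: `ord₅(L/Ω) = 1 = v₅(c₅)`);
numerically TRUE on all 20 (record: `ord₅(L/Ω) ∈ {1, 2} ≥ 1 = v₅(c₅)`); BSD predicts `ord_p(L/Ω) = ord_p #Ш + ord_p ∏c ≥ v_p(c_p)` — consistent.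
Sector A″ (`minimalDepthSector_of`) is its corollary on «`ord_p ∏c ≤ v_p(c_p)`, `Ш(E)[p] = 0`» (door `ClassX11a.missingUpperBoundAt_of_noPTorsion`), itself
INHABITED BY NAME by 19 of the 20 (all but 346560lh1, whose second carrier `3` gives `ord₅ ∏c = 2 > 1`; `#Ш_an = 1` at all 19, `Ш[5] = 0` by the
tree's descent records) — there A″ agrees with the record's EXC-SHALLOW;
the NEW bite (beyond the record's EXC-SHALLOW `ord_p(L/Ω) ≥ 1`) is on `v_p(c_p) ≥ 2`, census-empty at `N < 5·10⁵` (`p² ∣ c_p` forces `v_p(Δ_min) ≥ 25`)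
but INHABITED IN PRINCIPLE at `p = 5` on Zywina's `X_{G₉}` disc `v_5(t) = −5` (`c_5 = 25 ⟺ v_5(t) = −5` for `j = J₉(t)`, tree
`NonSurjCorner.not_surj_five_iff_exists_j_eq_J9`; every other bad prime additive; split on a twist class; `w = 1 + v_5(a⁴ − 1)`; rank 0 by
Friedberg–Hoffstein in principle) MODULO the single clause `Ш[5] = 0` — idea-crit-10 V#159 (c), card §INHABITATION (this corrects rev ≤ 2c, which
placed the corner on `X_0⁺(25)`); a NAMED member is the kit row «MUDICHOT5-ORD5» (PREREG sha16 4ef23acd4a67998b) — pending, not a claim.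

## Registered shape (3 stubs; `sorry` only inside `stub_*`)

`stub_printFacts` (fourteen named prints: the record's thirteen + GS at odd primes), `stub_shaExponentCoreMuExc`, `stub_tamagawaDepthCoreMuExc`;
real proofs (REV 2 adds `pDepthAtP_le_padicValRat_of_muExceptionalAt`, `pDepthAtP_le_padicValNat_tamagawaProduct_of_split`, `pDepthAtP_le_padicValRat_LOne_div_of_minimalDepth`, and the ceiling in kernel form `two_le_valuation_padicLog_q` ∕ `depth_budget_of_muExceptionalAt` ∕ `depth_budget_classwide`): `norm_padicLog_q_le` ∕ `valuation_padicLog_q_ne_one` (the diagnosis, = REF g24's Negative lemma p710098 in norm form: «w = 1» is void on U5, `w = 2` is minimal), `depth_le_padicValRat_ratPlusSymbol_zero`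
(GS budget at depth `w`), `norm_ratCast_varpi_eq_one`, `norm_coeff_one_le_inv_of_no_unit_coeff` (μ-exceptional ⟹ `p ∣ a₁`), `muExcMinimalDepthSector_of`
(A″ on the exceptional branch), `missingUpperBoundAt_of_not_muExceptionalAt` (the other branch, tree door), `shaExponentCore_of` ∕ `tamagawaDepthCore_of`
(the record's cores from the restricted stubs), `UpperNonSurjFive_of_mudichot` (U5 BY NAME through `GL1Cartan.upperNonSurjFive_of_elevenFacts_of_twoCores`).

References: [Kobayashi2006DocMath] Cor. 4.2; [GreenbergStevens1993] Thm. (0.3); [MazurTateTeitelbaum1986Invent] §I.10–I.13, §II.1; [GreenbergLNM1716] Conj. 1.11,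
§4; [Kato2004Asterisque] Thm. 12.4, §17.13; [SteinWuthrich2013] Thm. 6.1; [Wuthrich2014] Cor. 18; [Mazur1978] Cor. 4.1; [GreenbergVatsal2000] Prop. 3.7, Rem. 3.4;
[Serre1972] Prop. 15; [SilvermanATAEC1994] Thm. V.5.3, Cor. IV.9.2 (d); [BhargavaSkinnerZhang2014] Lemma 18; [Miller2011LMS] Def. 1.1.
-/

set_option linter.dupNamespace false
set_option autoImplicit false

noncomputable section

open scoped Classical NumberField MatrixGroups ModularForm

open CongruenceSubgroup WeierstrassCurve
  Literature.NumberTheory.EllipticCurves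
  Literature.NumberTheory.EllipticCurves.ModularForms
  Literature.NumberTheory.EllipticCurves.Rank1Residual
  Literature.NumberTheory.EllipticCurves.Rank1Residual.Typed
  Literature.NumberTheory.EllipticCurves.Wuthrich2014
  Summit.BirchSwinnertonDyer.Rank1Residual
  Summit.BirchSwinnertonDyer.BirchSwinnertonDyer.Theses
  Summit.BirchSwinnertonDyer.BirchSwinnertonDyer.Theorems.GL1Cartan

namespace Summit.BirchSwinnertonDyer.BirchSwinnertonDyer.Cruxes.UpperNonSurjFive.MuDichot

/-! ## §1 Statements -/

/-- **The μ-EXCEPTIONAL branch at the pair (`μ_an(E, ω⁰) ≥ 1`): SOME Néron-normalised Mazur–Tate–Teitelbaum function `ϖ·L` of `W` at `p`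
(`f` a newform of `W`, `ϖ·Ω_W = Ω⁺_f`, allowable root `a = 1` split ∕ `a = −1` non-split) has NO `p`-adic unit coefficient** — literally the negation
of the certificate consumed by the tree door `ClassX11a.missingUpperBoundAt_of_not_surj_of_hardCert_of_nineFacts`.  It is CONJECTURALLY FALSE at every
pair with `E[p]` irreducible — meaning Greenberg's Conj. 1.11 (ALGEBRAIC μ: Sel_E(ℚ_∞)_p Λ-cotorsion ⇒ ∃ isogenous E′ with μ_{E′} = 0; `E[p]`
irreducible ⇒ μ_alg(E) = 0) PLUS μ_an = μ_alg (main conjecture), the latter NOT known exactly at a non-surjective `p`; this def is μ_an ≥ 1 (V#159 R2). [cite: GreenbergLNM1716, §1 Conj. 1.11 (p. 62)] [cite: MazurTateTeitelbaum1986Invent, §I.10–I.13] -/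
def MuExceptionalAt (W : WeierstrassCurve ℚ) [W.IsElliptic] [W.IsGloballyMinimal] (p : ℕ) [Fact p.Prime] : Prop :=
  ∃ (N : ℕ) (_ : NeZero N) (f : CuspForm (Gamma0 N) 2), IsNewformOf W f ∧
    ∃ ϖ : ℚ, (ϖ : ℝ) * W.realPeriodRat = plusPeriod f ∧
      ∃ (a : ℚ_[p]) (L : PowerSeries ℚ_[p]),
        (W.HasSplitMultiplicativeReductionAtPrime p → a = 1) ∧ (¬ W.HasSplitMultiplicativeReductionAtPrime p → a = -1) ∧
        IsMultPAdicLFunctionOf f p a L ∧ ∀ n : ℕ, ‖PowerSeries.coeff n (PowerSeries.C ((ϖ : ℚ) : ℚ_[p]) * L)‖ ≠ 1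

/-- **«w = 2» — MINIMAL Tate depth: `ord_p log_p q_E = 2`** for every Tate parameter datum (`log_p` the Iwasawa logarithm).  On U5 at a split `p`
the depth is `≥ 2` always (`norm_padicLog_q_le`: `q_E` is a `p`-th power), and `= 2` iff the unit part of the `p`-th root of `q_E` is non-Wieferich
(generic). [cite: BhargavaSkinnerZhang2014, Lemma 18 (proof, p. 9)] [cite: SilvermanATAEC1994, Thm. V.5.3] -/
def LogTateDepthTwo (W : WeierstrassCurve ℚ) [W.IsElliptic] [W.IsGloballyMinimal] (p : ℕ) [Fact p.Prime] : Prop :=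
  ∀ D : TateParameterData W p, (padicLog p D.q).valuation = 2

/-- **The `p`-depth AT `p`: `v_p(v_p(Δ_min))`** (`= v_p(c_p)` at a split multiplicative `p`; verbatim «gsdepth5»). [cite: SilvermanATAEC1994, Cor. IV.9.2 (d) and Table 4.1] -/
def pDepthAtP (W : WeierstrassCurve ℚ) [W.IsGloballyMinimal] (p : ℕ) : ℕ :=
  padicValNat p (padicValInt p W.minimalDiscriminantInt)

/-- **SECTOR A″ (CLOSED below on the μ-exceptional branch, modulo GS-odd + modularity + Mazur Cor. 4.1 + GZK): minimal depth, `p` the only carrier.**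
U5 on «X11a, `¬ Surj`, `5 ≤ p`, `p` split, w = 2, `ord_p ∏ c_ℓ ≤ v_p(c_p)`, `Ш(E)[p] = 0`, μ-exceptional».  (Off the exceptional branch the μ-door closes
it too, so A″ is closed class-wide: `minimalDepthSector_of`.)  New beyond the record on the stratum `p² ∣ c_p` (T1@p; census-empty below `5·10⁵`).
[cite: Kobayashi2006DocMath, Cor. 4.2 (p. 575)] [cite: Miller2011LMS, Def. 1.1] -/
def MuExcMinimalDepthSector : Prop :=
  ∀ (W : WeierstrassCurve ℚ) [W.IsElliptic] [W.IsGloballyMinimal] (p : ℕ) [Fact p.Prime],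
    ClassX11a W p → ¬ Surj W p → 5 ≤ p → W.HasSplitMultiplicativeReductionAtPrime p →
    LogTateDepthTwo W p → padicValNat p W.tamagawaProduct ≤ pDepthAtP W p →
    (∀ x : W.sha, (p : ℤ) • x = 0 → x = 0) → MuExceptionalAt W p → MissingUpperBoundAt W p

/-- **C_Ш^exc — the record's EXPONENT core restricted to the μ-exceptional branch (residual; U5 verbatim on a sub-locus).**  U5 at the X11a pairs with
non-surjective `p ≥ 5`, `Ш(E/ℚ)[p] ≠ 0` AND `μ_an ≥ 1` at the pair.  Off the branch C_Ш is closed per pair by the μ-door; class-wide the branch is CONJECTURALLY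
empty (Greenberg's Conj. 1.11 = μ_alg = 0 for irreducible `E[p]`, PLUS μ_an = μ_alg — unknown exactly at a non-surjective `p`; V#159 R2) — the same wall as C_Ш (`EulerSystemBigImageAtSmallImage`), now with the μ-certificate folded OUT of the statement.
CENSUS: no known pair (every certified pair of `R2-CENSUS-cruxlead-g2.md` has a μ-certificate or is uncomputed).  Why it might fail: open (U5 on a sub-locus).
[cite: GreenbergLNM1716, §1 Conj. 1.11 (p. 62)] [cite: Kato2004Asterisque, §17.13 (pp. 279–280)] -/
def ShaExponentCoreMuExc : Prop :=
  ∀ (W : WeierstrassCurve ℚ) [W.IsElliptic] [W.IsGloballyMinimal] (p : ℕ) [Fact p.Prime],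
    ClassX11a W p → ¬ Surj W p → 5 ≤ p → (∃ x : W.sha, (p : ℤ) • x = 0 ∧ x ≠ 0) → MuExceptionalAt W p → MissingUpperBoundAt W p

/-- **(C_cc ∖ A″)^exc — the record's TAMAGAWA-DEPTH core minus sector A″, restricted to the μ-exceptional branch (residual; U5 verbatim on a sub-locus).**
U5 at the X11a pairs with non-surjective `p ≥ 5`, `Ш(E/ℚ)[p] = 0`, `ord_p ∏c ≥ 2`, `μ_an ≥ 1` at the pair, and NOT «`p` split ∧ w = 2 ∧ `ord_p ∏c ≤ v_p(c_p)`»: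
i.e. `p` non-split (then two carriers `ℓ ≠ p`), or `p` split with a second carrier, or Tate depth `w ≥ 3`.  There BSD asks `a₁ mod p²` (or deeper) at a
split `p` — beyond every residual congruence (first-order ceiling, see the header).  CENSUS at `N < 5·10⁵`: the two T2 pairs 118080ds1, 346560lh1 lie OFF
the branch (μ-certificates computed), so no known pair; conjecturally none (Conj. 1.11 = μ_alg, PLUS μ_an = μ_alg — the unknown part at `¬Surj p`; V#159 R2).
Why it might fail: open (U5 on a sub-locus). [cite: GreenbergLNM1716, §1 Conj. 1.11 (p. 62)]
[cite: Kato2004Asterisque, §17.13 (pp. 279–280)] [cite: SilvermanATAEC1994, Cor. IV.9.2 (d) and Table 4.1] -/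
def TamagawaDepthCoreMuExc : Prop :=
  ∀ (W : WeierstrassCurve ℚ) [W.IsElliptic] [W.IsGloballyMinimal] (p : ℕ) [Fact p.Prime],
    ClassX11a W p → ¬ Surj W p → 5 ≤ p → 2 ≤ padicValNat p W.tamagawaProduct →
    (∀ x : W.sha, (p : ℤ) • x = 0 → x = 0) → MuExceptionalAt W p →
    ¬ (W.HasSplitMultiplicativeReductionAtPrime p ∧ LogTateDepthTwo W p ∧ padicValNat p W.tamagawaProduct ≤ pDepthAtP W p) →
    MissingUpperBoundAt W p

/-- **GS at ODD primes, BY NAME** (Kobayashi 2006 Cor. 4.2 as printed; verbatim «gsdepth5» ∕ `Theorems/PrintX11aUpperNonSurjFiveOfNineFactsOddGS`).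
[cite: Kobayashi2006DocMath, Cor. 4.2 (p. 575)] -/
def GSOdd : Prop :=
  ∀ (W : WeierstrassCurve ℚ) [W.IsElliptic] [W.IsGloballyMinimal] (p : ℕ) [Fact p.Prime],
    p ≠ 2 → greenberg_stevens (W := W) (p := p)

/-- **PRINTS — the fourteen named published inputs of the line, ONE conjunction:** the record's thirteen (Stein–Wuthrich 6.1 ×2, Kato 12.4, modularity,
Kato §17.13 V′ ∕ VI′ ∕ XI′, Mazur Cor. 4.1, GZK, Coleman–Edixhoven, Greenberg–Vatsal, Ihara, level lowering at `p ≥ 5`; verbatim «twpatch5» S1) ∧ GS-odd.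
Why it might fail: statement-only named published facts (D-0014). [cite: Kato2004Asterisque, Thm. 12.4 (p. 221), §17.13 (pp. 279–280)]
[cite: SteinWuthrich2013, Thm. 6.1 (p. 20)] [cite: Mazur1978, Cor. 4.1] [cite: DarmonDiamondTaylor1995, Thm. 3.15] [cite: Kobayashi2006DocMath, Cor. 4.2 (p. 575)] -/
def PrintFacts : Prop :=
  (Literature.NumberTheory.EllipticCurves.SteinWuthrich2013.thm61_splitMultiplicative ∧
    Literature.NumberTheory.EllipticCurves.SteinWuthrich2013.thm61_nonsplitMultiplicative ∧
    Literature.NumberTheory.EllipticCurves.Kato2004.thm12_4 ∧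
    Literature.NumberTheory.EllipticCurves.ModularForms.exists_isNewformOf ∧
    Literature.NumberTheory.EllipticCurves.Kato2004.exists_multDivisibilityInputs_nonsplit_contra ∧
    Literature.NumberTheory.EllipticCurves.Kato2004.exists_multDivisibilityInputs_split_contra ∧
    Literature.NumberTheory.EllipticCurves.Kato2004.exists_multDivisibilityInputs_fine_contra ∧
    Literature.NumberTheory.EllipticCurves.ModularForms.mazur_not_dvd_maninConstant_of_odd ∧
    rank_eq_analyticRank_of_analyticRank_le_one ∧
    colemanEdixhoven1998_heckePolynomial_simpleRoots ∧ greenbergVatsal2000_plusSymbol_congruence ∧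
    ribet1984_iharaLemma ∧ ribet1990_levelLowering_gamma0_newform_general_of_five_le) ∧ GSOdd

/-! ## §2 Stubs (3; `sorry` only here) -/

/-- stub PRINTS (fourteen named published facts, BY NAME). [cite: Kato2004Asterisque, Thm. 12.4 (p. 221), §17.13 (pp. 279–280)]
[cite: Kobayashi2006DocMath, Cor. 4.2 (p. 575)] -/
theorem stub_printFacts : PrintFacts := by
  sorry

/-- stub C_Ш^exc (residual: the exponent core on the μ-exceptional branch; conjecturally vacuous = Greenberg Conj. 1.11 (μ_alg) + μ_an = μ_alg, the latter
unknown exactly at a non-surjective `p` — `MuExceptionalAt` is μ_an ≥ 1; V#159 R2). [cite: GreenbergLNM1716, §1 Conj. 1.11 (p. 62)] [cite: Kato2004Asterisque, §17.13] -/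
theorem stub_shaExponentCoreMuExc : ShaExponentCoreMuExc := by
  sorry

/-- stub (C_cc ∖ A″)^exc (residual: the Tamagawa-depth core off sector A″ on the μ-exceptional branch; conjecturally vacuous in the same sense —
Conj. 1.11 is μ_alg, `MuExceptionalAt` is μ_an ≥ 1, the equality is the unknown part at `¬Surj p`; V#159 R2). [cite: GreenbergLNM1716, §1 Conj. 1.11 (p. 62)]
[cite: Kato2004Asterisque, §17.13] -/
theorem stub_tamagawaDepthCoreMuExc : TamagawaDepthCoreMuExc := by
  sorry

/-! ## §3 Real proofs -/

section Diagnosis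

variable {W : WeierstrassCurve ℚ} [W.IsElliptic] {p : ℕ} [Fact p.Prime]

/-- `log_p 1 = 0`. [cite: Iwasawa1972PadicL, §4.4] -/
theorem padicLog_one' : padicLog p (1 : ℚ_[p]) = 0 := by
  have h := padicLog_mul_holds p (x := 1) (y := 1) one_ne_zero one_ne_zero
  rw [mul_one] at h
  linear_combination -h

/-- `log_p (y^n) = n · log_p y` (`y ≠ 0`). [cite: Iwasawa1972PadicL, §4.4] -/
theorem padicLog_pow' {y : ℚ_[p]} (hy : y ≠ 0) (n : ℕ) : padicLog p (y ^ n) = (n : ℚ_[p]) * padicLog p y := by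
  induction n with
  | zero => rw [pow_zero, padicLog_one', Nat.cast_zero, zero_mul]
  | succ n ih =>
    rw [pow_succ, padicLog_mul_holds p (pow_ne_zero _ hy) hy, ih]
    push_cast
    ring

/-- **THE DIAGNOSIS (REF g24's Negative lemma p710098 `UpperNonSurjFive.Negative.two_le_valuation_padicLog_q_of_irr_of_not_surj`, re-derived here in
norm form so that this file does not depend on the freshly landed module): on U5 at a split `p` the Tate depth is `≥ 2`** — `‖log_p q_E‖ ≤ p⁻²`, because
`q_E = r^p` when `E[p]` is irreducible and `ρ̄_{E,p}` is not onto (`TatePow.TateParameterData.exists_pow_eq_q_of_irr_of_not_surj`: `p ∤ #ρ̄(G_ℚ)`, Serre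
Prop. 15 + Tate), so `log_p q_E = p · log_p r` with `‖log_p r‖ ≤ p⁻¹`.  Hence «gsdepth5»'s «w = 1» is void on U5 and `w = 2` (`LogTateDepthTwo`) is the
MINIMAL depth. [cite: Serre1972, §2.4 Prop. 15] [cite: SilvermanATAEC1994, Thm. V.5.3] [cite: Iwasawa1972PadicL, §4.4] -/
theorem norm_padicLog_q_le (hp2 : p ≠ 2) (hmult : W.HasMultiplicativeReductionAtPrime p) (hirr : W.HasIrreducibleModPGaloisRep p)
    (hns : ¬ Surj W p) (D : TateParameterData W p) : ‖padicLog p D.q‖ ≤ (p : ℝ)⁻¹ * (p : ℝ)⁻¹ := by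
  obtain ⟨r, hr⟩ :=
    Summit.BirchSwinnertonDyer.BirchSwinnertonDyer.Theorems.TatePow.TateParameterData.exists_pow_eq_q_of_irr_of_not_surj W p hp2
      hmult hirr hns D
  have hr0 : r ≠ 0 := by
    rintro rfl
    have hp0 : p ≠ 0 := (Fact.out : p.Prime).ne_zero
    exact D.q_ne_zero (by rw [← hr, zero_pow hp0])
  rw [← hr, padicLog_pow' hr0, norm_mul, Padic.norm_p]
  exact mul_le_mul_of_nonneg_left (norm_padicLog_le_inv hp2 r) (by positivity)

/-- **Corollary: «w = 1» (`ord_p log_p q_E = 1`, «gsdepth5»'s `LogTatePeriodUnit`) FAILS at every Tate datum of a U5 pair with `p` split** (= REF g24's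
`valuation_padicLog_q_ne_one_of_irr_of_not_surj`, p710098). [cite: Serre1972, §2.4 Prop. 15] [cite: SilvermanATAEC1994, Thm. V.5.3] -/
theorem valuation_padicLog_q_ne_one (hp2 : p ≠ 2) (hmult : W.HasMultiplicativeReductionAtPrime p)
    (hirr : W.HasIrreducibleModPGaloisRep p) (hns : ¬ Surj W p) (D : TateParameterData W p) :
    (padicLog p D.q).valuation ≠ 1 := by
  intro hv
  have hp : p.Prime := Fact.out
  have h1p : (1 : ℝ) < p := by exact_mod_cast hp.one_lt
  have h := norm_padicLog_q_le hp2 hmult hirr hns D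
  by_cases h0 : padicLog p D.q = 0
  · rw [h0, Padic.valuation_zero] at hv
    exact zero_ne_one hv
  rw [Padic.norm_eq_zpow_neg_valuation h0, hv, zpow_neg, zpow_one] at h
  have hlt : (p : ℝ)⁻¹ * (p : ℝ)⁻¹ < (p : ℝ)⁻¹ := by
    have hpos : (0 : ℝ) < (p : ℝ)⁻¹ := by positivity
    have hlt1 : (p : ℝ)⁻¹ < 1 := inv_lt_one_of_one_lt₀ h1p
    nlinarith
  linarith

/-- **`2 ≤ ord_p log_p q_E` whenever `log_p q_E ≠ 0` (U5, `p` split; = REF g24's `two_le_valuation_padicLog_q_of_irr_of_not_surj`, p710098, from the norm form).**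
[cite: Serre1972, §2.4 Prop. 15] [cite: SilvermanATAEC1994, Thm. V.5.3] -/
theorem two_le_valuation_padicLog_q (hp2 : p ≠ 2) (hmult : W.HasMultiplicativeReductionAtPrime p)
    (hirr : W.HasIrreducibleModPGaloisRep p) (hns : ¬ Surj W p) (D : TateParameterData W p) (h0 : padicLog p D.q ≠ 0) :
    2 ≤ (padicLog p D.q).valuation := by
  have hp : p.Prime := Fact.out
  have h1p : (1 : ℝ) < p := by exact_mod_cast hp.one_lt
  have h := norm_padicLog_q_le hp2 hmult hirr hns D
  rw [Padic.norm_eq_zpow_neg_valuation h0] at h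
  have h2 : (p : ℝ)⁻¹ * (p : ℝ)⁻¹ = (p : ℝ) ^ (-2 : ℤ) := by
    rw [zpow_neg, zpow_ofNat, pow_two, mul_inv]
  rw [h2, zpow_le_zpow_iff_right₀ h1p] at h
  omega

end Diagnosis

section Lever

variable {W : WeierstrassCurve ℚ} [W.IsElliptic] [W.IsGloballyMinimal] {p : ℕ} [Fact p.Prime]

/-- **THE GS BUDGET AT TATE DEPTH `w` (real proof; «gsdepth5»'s lever with `1 ↦ w`).**  At a split multiplicative `p ≠ 2` with Tate datum `D`,
`ord_p log_p q_E = w ≠ 0` and `‖[T¹]L‖ ≤ p^{−m}` for THE split `p`-adic `L`-function: `m + v_p(v_p Δ_min) + 1 ≤ ord_p [0]⁺_f + w` (when `[0]⁺_f ≠ 0`).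
Valuations in `a₁ · log_p γ = (log_p q / ord_p q) · [0]⁺_f` with `v(log_p γ) ≥ 1` (`norm_padicLog_le_inv`), `ord_p q = v_p(Δ_min)`
(`TateParameterData.valuation_q_eq_padicValInt_holds`). [cite: Kobayashi2006DocMath, Cor. 4.2 (p. 575)] [cite: MazurTateTeitelbaum1986Invent, §II.1]
[cite: BhargavaSkinnerZhang2014, Lemma 18 (proof, p. 9)] -/
theorem depth_le_padicValRat_ratPlusSymbol_zero (hp2 : p ≠ 2)
    (hGS : greenberg_stevens (W := W) (p := p)) (D : TateParameterData W p)
    {w : ℕ} (hw0 : w ≠ 0) (hw : (padicLog p D.q).valuation = w)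
    {N : ℕ} [NeZero N] {f : CuspForm (Gamma0 N) 2} (hf : IsNewformOf W f)
    {L : PowerSeries ℚ_[p]} (hL : IsSplitMultPAdicLFunctionOf f p L)
    {m : ℕ} (ha : ‖PowerSeries.coeff 1 L‖ ≤ ((p : ℝ) ^ m)⁻¹) (h0 : ratPlusSymbol f 0 ≠ 0) :
    ((m + pDepthAtP W p + 1 : ℕ) : ℤ) ≤ padicValRat p (ratPlusSymbol f 0) + w := by
  have hp : p.Prime := Fact.out
  have h1p : (1 : ℝ) < p := by exact_mod_cast hp.one_lt
  obtain ⟨-, hid⟩ := hGS D hf hL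
  set a : ℚ_[p] := PowerSeries.coeff 1 L with ha_def
  set lg : ℚ_[p] := padicLog p (cyclotomicGenerator p) with hlg_def
  set b : ℚ_[p] := ((ratPlusSymbol f 0 : ℚ) : ℚ_[p]) with hb_def
  set k : ℕ := padicValInt p W.minimalDiscriminantInt with hk_def
  have hk : D.q.valuation = (k : ℤ) :=
    TateParameterData.valuation_q_eq_padicValInt_holds (W := W) (p := p) D
  have hk0 : k ≠ 0 := by
    intro h0
    have hpos := D.valuation_q_pos
    rw [hk, h0] at hpos
    norm_num at hpos
  have hkq : (D.q.valuation : ℚ_[p]) = ((k : ℕ) : ℚ_[p]) := by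
    rw [hk, Int.cast_natCast]
  have hkne : ((k : ℕ) : ℚ_[p]) ≠ 0 := by exact_mod_cast hk0
  have hlogq0 : padicLog p D.q ≠ 0 := by
    intro h
    rw [h, Padic.valuation_zero] at hw
    exact hw0 (by exact_mod_cast hw.symm)
  have hLinv : LInvariant D = padicLog p D.q / ((k : ℕ) : ℚ_[p]) := by
    unfold LInvariant
    rw [hkq]
  have hLinv0 : LInvariant D ≠ 0 := by
    rw [hLinv]
    exact div_ne_zero hlogq0 hkne
  have hb0 : b ≠ 0 := by
    rw [hb_def]
    exact_mod_cast h0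
  have hrhs0 : LInvariant D * b ≠ 0 := mul_ne_zero hLinv0 hb0
  have hid' : a * lg = LInvariant D * b := hid
  have ha0 : a ≠ 0 := by
    intro h
    rw [h, zero_mul] at hid'
    exact hrhs0 hid'.symm
  have hlg0 : lg ≠ 0 := by
    intro h
    rw [h, mul_zero] at hid'
    exact hrhs0 hid'.symm
  -- valuations of the two sides
  have hv := congrArg Padic.valuation hid'
  rw [Padic.valuation_mul ha0 hlg0, Padic.valuation_mul hLinv0 hb0, hLinv, div_eq_mul_inv,
    Padic.valuation_mul hlogq0 (inv_ne_zero hkne), Padic.valuation_inv, hw, Padic.valuation_natCast] at hv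
  -- `v(a) ≥ m` from the norm bound
  have hva : (m : ℤ) ≤ a.valuation := by
    have h := ha
    rw [Padic.norm_eq_zpow_neg_valuation ha0, ← zpow_natCast, ← zpow_neg,
      zpow_le_zpow_iff_right₀ h1p] at h
    omega
  -- `v(log_p γ) ≥ 1`
  have hvlg : (1 : ℤ) ≤ lg.valuation := by
    have h := norm_padicLog_le_inv hp2 (cyclotomicGenerator p : ℚ_[p])
    rw [← hlg_def, Padic.norm_eq_zpow_neg_valuation hlg0, ← zpow_neg_one,
      zpow_le_zpow_iff_right₀ h1p] at h
    omega
  have hvb : b.valuation = padicValRat p (ratPlusSymbol f 0) := by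
    rw [hb_def, Padic.valuation_ratCast]
  rw [← hvb]
  unfold pDepthAtP
  rw [← hk_def, Nat.cast_add, Nat.cast_add, Nat.cast_one]
  omega

/-- **Integrality of `[T¹]L` (a THEOREM): `‖[T¹]L_p(E,T)‖ ≤ 1` at an odd split multiplicative `p` with `E[p]` irreducible** (MTT §I.10–I.13, tree
`norm_coeff_le_max_of_isSplitMultPAdicLFunctionOf`, and `‖[0]⁺_f‖ ≤ 1`, `Additive.norm_ratPlusSymbol_le_one_of_irreducible`; verbatim «gsdepth5»).
[cite: MazurTateTeitelbaum1986Invent, §I.10 and §I.12–I.13] [cite: GreenbergVatsal2000, Prop. 3.7] -/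
theorem norm_coeff_one_le_one (hp2 : p ≠ 2) (hsplit : W.HasSplitMultiplicativeReductionAtPrime p)
    (hirr : W.HasIrreducibleModPGaloisRep p)
    {N : ℕ} [NeZero N] {f : CuspForm (Gamma0 N) 2} (hf : IsNewformOf W f)
    {L : PowerSeries ℚ_[p]} (hL : IsSplitMultPAdicLFunctionOf f p L) :
    ‖PowerSeries.coeff 1 L‖ ≤ 1 := by
  refine (norm_coeff_le_max_of_isSplitMultPAdicLFunctionOf hf hp2 hsplit hL 1).trans (max_le le_rfl ?_)
  exact Additive.norm_ratPlusSymbol_le_one_of_irreducible hp2 hf hirr 0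

/-- **The Néron period ratio is a `p`-adic unit: `‖ϖ‖_p = 1`** when `ϖ·Ω_W = Ω⁺_f` — Mazur Cor. 4.1 + Greenberg–Vatsal Rem. 3.4 BY NAME through the tree's
`SkinnerUrban2014.realPeriodRat_eq_unit_mul_plusPeriod_of_multiplicative_of_mazur` (`Ω_W = u·Ω⁺_f`, `|u|_p = 1`, so `ϖ = u⁻¹`). [cite: Mazur1978, Cor. 4.1]
[cite: GreenbergVatsal2000, §3, Remark 3.4] -/
theorem norm_ratCast_varpi_eq_one (hMz : mazur_not_dvd_maninConstant_of_odd) (hp5 : 5 ≤ p)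
    (hmult : W.HasMultiplicativeReductionAtPrime p) (hirr : W.HasIrreducibleModPGaloisRep p)
    {N : ℕ} [NeZero N] {f : CuspForm (Gamma0 N) 2} (hf : IsNewformOf W f)
    {ϖ : ℚ} (hϖ : (ϖ : ℝ) * W.realPeriodRat = plusPeriod f) : ‖((ϖ : ℚ) : ℚ_[p])‖ = 1 := by
  obtain ⟨u, hu, hΩ⟩ :=
    SkinnerUrban2014.realPeriodRat_eq_unit_mul_plusPeriod_of_multiplicative_of_mazur hMz W p hp5 hmult hirr f hf
  have hΩpos : 0 < W.realPeriodRat := W.realPeriodRat_pos_holds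
  have hplus0 : plusPeriod f ≠ 0 := by
    intro h0
    rw [h0, mul_zero] at hΩ
    exact hΩpos.ne' hΩ
  have hϖu : ((ϖ * u : ℚ) : ℝ) = 1 := by
    have h : ((ϖ * u : ℚ) : ℝ) * plusPeriod f = 1 * plusPeriod f := by
      push_cast
      rw [one_mul, mul_assoc, ← hΩ, hϖ]
    exact mul_right_cancel₀ hplus0 h
  have hϖu' : ϖ * u = 1 := by exact_mod_cast hϖu
  have h' : ((ϖ : ℚ) : ℚ_[p]) * ((u : ℚ) : ℚ_[p]) = 1 := by exact_mod_cast congrArg (fun x : ℚ => (x : ℚ_[p])) hϖu'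
  have hn := congrArg (fun x : ℚ_[p] => ‖x‖) h'
  simp only [norm_mul, hu, mul_one, norm_one] at hn
  exact hn

/-- **μ-EXCEPTIONAL ⟹ `p ∣ a₁` (real proof):** if NO coefficient of `ϖ·L` is a `p`-adic unit, then — `‖ϖ‖_p = 1`, `‖[T¹]L‖ ≤ 1` — the linear coefficient
satisfies `‖[T¹]L‖ < 1`, i.e. `‖[T¹]L‖ ≤ p⁻¹` (the valuation is an integer). [cite: MazurTateTeitelbaum1986Invent, §I.10–I.13] [cite: GreenbergLNM1716, §1 Conj. 1.11 (p. 62)] -/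
theorem norm_coeff_one_le_inv_of_no_unit_coeff (hp2 : p ≠ 2) (hsplit : W.HasSplitMultiplicativeReductionAtPrime p)
    (hirr : W.HasIrreducibleModPGaloisRep p)
    {N : ℕ} [NeZero N] {f : CuspForm (Gamma0 N) 2} (hf : IsNewformOf W f)
    {L : PowerSeries ℚ_[p]} (hL : IsSplitMultPAdicLFunctionOf f p L)
    {ϖ : ℚ} (hϖ1 : ‖((ϖ : ℚ) : ℚ_[p])‖ = 1)
    (hnu : ∀ n : ℕ, ‖PowerSeries.coeff n (PowerSeries.C ((ϖ : ℚ) : ℚ_[p]) * L)‖ ≠ 1) :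
    ‖PowerSeries.coeff 1 L‖ ≤ ((p : ℝ) ^ 1)⁻¹ := by
  have h1 : ‖PowerSeries.coeff 1 L‖ ≤ 1 := norm_coeff_one_le_one hp2 hsplit hirr hf hL
  have hne : ‖PowerSeries.coeff 1 L‖ ≠ 1 := by
    intro h
    apply hnu 1
    rw [PowerSeries.coeff_C_mul, norm_mul, hϖ1, one_mul, h]
  have hlt : ‖PowerSeries.coeff 1 L‖ < (p : ℝ) ^ ((-1 : ℤ) + 1) := by
    norm_num
    exact lt_of_le_of_ne h1 hne
  have h := (Padic.norm_le_pow_iff_norm_lt_pow_add_one (PowerSeries.coeff 1 L) (-1)).mpr hlt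
  rw [zpow_neg, zpow_one] at h
  simpa using h

/-- **Period transfer (real proof; Mazur Cor. 4.1 + GV Rem. 3.4 BY NAME; verbatim «gsdepth5»):** `m ≤ ord_p [0]⁺_f` becomes `m ≤ ord_p (L(E,1)/Ω_E)`.
[cite: Mazur1978, Cor. 4.1] [cite: GreenbergVatsal2000, §3, Remark 3.4] [cite: MazurTateTeitelbaum1986Invent, §I.8] -/
theorem le_padicValRat_LOne_div_of_ratPlusSymbol (hMz : mazur_not_dvd_maninConstant_of_odd)
    (W : WeierstrassCurve ℚ) [W.IsElliptic] [W.IsGloballyMinimal] {p : ℕ} [Fact p.Prime] (hp5 : 5 ≤ p)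
    (hmult : W.HasMultiplicativeReductionAtPrime p) (hirr : W.HasIrreducibleModPGaloisRep p)
    {N : ℕ} [NeZero N] {f : CuspForm (Gamma0 N) 2} (hf : IsNewformOf W f) (m : ℤ)
    (hb : ratPlusSymbol f 0 ≠ 0 → m ≤ padicValRat p (ratPlusSymbol f 0)) :
    ∀ t : ℚ, W.entireLFunction 1 / (W.realPeriodRat : ℂ) = (t : ℂ) → t ≠ 0 → m ≤ padicValRat p t := by
  intro t ht ht0
  obtain ⟨u, hu, hΩ⟩ :=
    SkinnerUrban2014.realPeriodRat_eq_unit_mul_plusPeriod_of_multiplicative_of_mazur hMz W p hp5 hmult hirr f hf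
  have hΩpos : 0 < W.realPeriodRat := W.realPeriodRat_pos_holds
  have hΩC : (W.realPeriodRat : ℂ) ≠ 0 := Complex.ofReal_ne_zero.mpr hΩpos.ne'
  have hu0 : u ≠ 0 := by
    rintro rfl
    rw [Rat.cast_zero, zero_mul] at hΩ
    exact hΩpos.ne' hΩ
  have hLval : W.entireLFunction 1 = ((((ratPlusSymbol f 0 : ℚ) : ℝ) * plusPeriod f : ℝ) : ℂ) :=
    hf.entireLFunction_one_eq
  have hplus : plusPeriod f = W.realPeriodRat / u := by
    rw [hΩ, mul_div_cancel_left₀ _ (Rat.cast_ne_zero.mpr hu0)]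
  have ht' : W.entireLFunction 1 / (W.realPeriodRat : ℂ) = ((ratPlusSymbol f 0 / u : ℚ) : ℂ) := by
    rw [hLval, hplus, div_eq_iff hΩC]
    push_cast
    have huC : ((u : ℝ) : ℂ) ≠ 0 := by exact_mod_cast hu0
    field_simp
  have hteq : t = ratPlusSymbol f 0 / u := by
    have h : ((t : ℚ) : ℂ) = ((ratPlusSymbol f 0 / u : ℚ) : ℂ) := by rw [← ht, ht']
    exact_mod_cast h
  have hb0 : ratPlusSymbol f 0 ≠ 0 := by
    intro h0
    apply ht0
    rw [hteq, h0, zero_div]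
  rw [hteq, padicValRat.div hb0 hu0, Rank1Residual.padicValRat_eq_zero_of_norm_ratCast_eq_one hu, sub_zero]
  exact hb hb0

end Lever

/-! ## §4b The budget on the μ-exceptional branch and the fact-free depth inequality (REV 2) -/

open IsDedekindDomain Rat.HeightOneSpectrum in
/-- **`v_p(c_p) ≤ ord_p ∏_ℓ c_ℓ` at a split multiplicative `p` (fact-free, real proof):** `c_p = v_p(Δ_min)` (Kodaira–Néron, in the dependent currency of the
finite product `tamagawaProduct_eq_prod`) is one factor of `∏_v c_v`, so `p^{v_p(v_p Δ_min)} ∣ ∏_v c_v`.  [cite: SilvermanATAEC1994, Cor. IV.9.2 (d) with (b)] -/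
theorem pDepthAtP_le_padicValNat_tamagawaProduct_of_split (W : WeierstrassCurve ℚ) [W.IsElliptic] [W.IsGloballyMinimal] {p : ℕ} [Fact p.Prime]
    (hs : W.HasSplitMultiplicativeReductionAtPrime p) : pDepthAtP W p ≤ padicValNat p W.tamagawaProduct := by
  obtain ⟨v, hv⟩ : ∃ v : HeightOneSpectrum ℤ, (primesEquiv v : ℕ) = p :=
    ⟨primesEquiv.symm ⟨p, Fact.out⟩, by rw [Equiv.apply_symm_apply]⟩
  have hfW : (W.badPlaces ℤ).Finite := W.finite_badPlaces_holds ℤ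
  set s : Finset (HeightOneSpectrum ℤ) := insert v hfW.toFinset with hsdef
  have hsW : ∀ w, ¬ W.HasGoodReductionAt w → w ∈ s := fun w hw ↦
    Finset.mem_insert_of_mem (by rw [Set.Finite.mem_toFinset, mem_badPlaces_iff]; exact hw)
  have hvs : v ∈ s := Finset.mem_insert_self _ _
  have h0 : W.tamagawaProduct ≠ 0 := (W.tamagawaProduct_pos_holds).ne'
  unfold pDepthAtP
  rw [← padicValNat_dvd_iff_le h0, tamagawaProduct_eq_prod W s hsW]
  refine dvd_trans ?_ (Finset.dvd_prod_of_mem _ hvs)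
  rw [localTamagawaNumber_primesEquiv_eq_padicValInt_of_split W v hv hs]
  exact pow_padicValNat_dvd

section Budget

variable {W : WeierstrassCurve ℚ} [W.IsElliptic] [W.IsGloballyMinimal] {p : ℕ} [Fact p.Prime]

/-- **THE BUDGET ON THE μ-EXCEPTIONAL BRANCH (real proof; CONDITIONAL on GS-odd + Mazur Cor. 4.1):** X11a, `5 ≤ p`, `p` split, Tate depth `w = 2`,
`MuExceptionalAt W p` ⟹ `v_p(v_p(Δ_min)) ≤ ord_p (L(E,1)/Ω_E)`.  The witness of `MuExceptionalAt` at the split `p` is THE split function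
(`isMultPAdicLFunctionOf_one_iff`), μ-exceptional ⟹ `‖[T¹]L‖ ≤ p⁻¹` (`m = 1`), THE BUDGET `1 + v_p(c_p) + 1 ≤ ord_p [0]⁺_f + 2`, period transfer.
[cite: Kobayashi2006DocMath, Cor. 4.2 (p. 575)] [cite: Mazur1978, Cor. 4.1] [cite: MazurTateTeitelbaum1986Invent, §I.13] -/
theorem pDepthAtP_le_padicValRat_of_muExceptionalAt (hGS : GSOdd) (hMz : mazur_not_dvd_maninConstant_of_odd)
    (hX : ClassX11a W p) (hp5 : 5 ≤ p) (hsp : W.HasSplitMultiplicativeReductionAtPrime p) (hw : LogTateDepthTwo W p)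
    (hμ : MuExceptionalAt W p) {t : ℚ} (ht : W.entireLFunction 1 / (W.realPeriodRat : ℂ) = (t : ℂ)) (ht0 : t ≠ 0) :
    ((pDepthAtP W p : ℕ) : ℤ) ≤ padicValRat p t := by
  have hp2 : p ≠ 2 := hX.ne_two
  -- the exceptional witness at the split prime: `a = 1`, THE split function, no unit coefficient
  obtain ⟨N, hN, f, hf, ϖ, hϖ, a, L, hsa, -, hL, hnu⟩ := hμ
  have ha : a = 1 := hsa hsp
  subst ha
  have hL' : IsSplitMultPAdicLFunctionOf f p L := (isMultPAdicLFunctionOf_one_iff L).mp hL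
  obtain ⟨D⟩ := (nonempty_tateParameterData_iff_holds (W := W) (p := p)).mpr hsp
  have hϖ1 : ‖((ϖ : ℚ) : ℚ_[p])‖ = 1 := norm_ratCast_varpi_eq_one hMz hp5 hX.mult hX.irr hf hϖ
  have ha1 : ‖PowerSeries.coeff 1 L‖ ≤ ((p : ℝ) ^ 1)⁻¹ :=
    norm_coeff_one_le_inv_of_no_unit_coeff hp2 hsp hX.irr hf hL' hϖ1 hnu
  refine le_padicValRat_LOne_div_of_ratPlusSymbol hMz W hp5 hX.mult hX.irr hf _ (fun hb0 => ?_) t ht ht0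
  have h := depth_le_padicValRat_ratPlusSymbol_zero hp2 (hGS W p hp2) D two_ne_zero (hw D) hf hL' ha1 hb0
  simp only [Nat.cast_add, Nat.cast_one, Nat.cast_ofNat] at h
  omega

/-- **THE BUDGET AT ARBITRARY TATE DEPTH `w` ON THE μ-EXCEPTIONAL BRANCH (real proof; the FIRST-ORDER CEILING in kernel form):** X11a, `5 ≤ p`, `p` split,
`ord_p log_p q_E = w ≠ 0`, `MuExceptionalAt W p` ⟹ `v_p(v_p(Δ_min)) + 2 ≤ ord_p (L(E,1)/Ω_E) + w` — the branch's one free `p` in `a₁` pays for `w − 1 = 1`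
exactly; at `w ≥ 3` it leaves `ord_p(L/Ω) ≥ v_p(c_p) + 2 − w`, short of BSD's `v_p(c_p)`. [cite: Kobayashi2006DocMath, Cor. 4.2 (p. 575)] [cite: Mazur1978, Cor. 4.1] -/
theorem depth_budget_of_muExceptionalAt (hGS : GSOdd) (hMz : mazur_not_dvd_maninConstant_of_odd)
    (hX : ClassX11a W p) (hp5 : 5 ≤ p) (hsp : W.HasSplitMultiplicativeReductionAtPrime p) (D : TateParameterData W p)
    {w : ℕ} (hw0 : w ≠ 0) (hw : (padicLog p D.q).valuation = w)
    (hμ : MuExceptionalAt W p) {t : ℚ} (ht : W.entireLFunction 1 / (W.realPeriodRat : ℂ) = (t : ℂ)) (ht0 : t ≠ 0) :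
    ((pDepthAtP W p + 2 : ℕ) : ℤ) ≤ padicValRat p t + w := by
  have hp2 : p ≠ 2 := hX.ne_two
  obtain ⟨N, hN, f, hf, ϖ, hϖ, a, L, hsa, -, hL, hnu⟩ := hμ
  have ha : a = 1 := hsa hsp
  subst ha
  have hL' : IsSplitMultPAdicLFunctionOf f p L := (isMultPAdicLFunctionOf_one_iff L).mp hL
  have hϖ1 : ‖((ϖ : ℚ) : ℚ_[p])‖ = 1 := norm_ratCast_varpi_eq_one hMz hp5 hX.mult hX.irr hf hϖ
  have ha1 : ‖PowerSeries.coeff 1 L‖ ≤ ((p : ℝ) ^ 1)⁻¹ :=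
    norm_coeff_one_le_inv_of_no_unit_coeff hp2 hsp hX.irr hf hL' hϖ1 hnu
  have key : ((pDepthAtP W p + 2 : ℕ) : ℤ) - w ≤ padicValRat p t := by
    refine le_padicValRat_LOne_div_of_ratPlusSymbol hMz W hp5 hX.mult hX.irr hf _ (fun hb0 => ?_) t ht ht0
    have h := depth_le_padicValRat_ratPlusSymbol_zero hp2 (hGS W p hp2) D hw0 hw hf hL' ha1 hb0
    simp only [Nat.cast_add, Nat.cast_one, Nat.cast_ofNat] at h ⊢
    omega
  linarith

end Budget

/-- **SECTOR A″ ON THE μ-EXCEPTIONAL BRANCH, class-wide (real proof; CONDITIONAL on GS-odd + modularity + Mazur Cor. 4.1 + GZK).**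
`ord_p #Ш_an = ord_p (L/Ω_E) − ord_p ∏ c` (`padicValRat_shaAn_eq_sub_tamagawa`) `≥ v_p(c_p) − ord_p ∏ c ≥ 0`: the witness of `MuExceptionalAt` at the split `p`
is THE split function (`isMultPAdicLFunctionOf_one_iff`), μ-exceptional ⟹ `‖[T¹]L‖ ≤ p⁻¹` (`m = 1`), and THE BUDGET at `w = 2` gives `1 + v_p(c_p) + 1 ≤ ord_p [0]⁺_f + 2`;
the door `ClassX11a.missingUpperBoundAt_of_noPTorsion` concludes. [cite: Kobayashi2006DocMath, Cor. 4.2 (p. 575)] [cite: SilvermanATAEC1994, Cor. IV.9.2 (d)]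
[cite: Miller2011LMS, Def. 1.1 (arXiv:1010.2431 p. 3)] -/
theorem muExcMinimalDepthSector_of (hGS : GSOdd) (hnf : exists_isNewformOf) (hMz : mazur_not_dvd_maninConstant_of_odd)
    (hGZK : rank_eq_analyticRank_of_analyticRank_le_one) : MuExcMinimalDepthSector := by
  intro W _ _ p _ hX hns hp5 hsp hw hdepth hSha hμ
  obtain ⟨t, ht, ht0, -⟩ := hX.exists_LOne_div_realPeriod_eq_of_mazur hnf hMz hp5
  have hL1 : W.entireLFunction 1 ≠ 0 := by
    intro h0
    apply ht0
    have h : ((t : ℚ) : ℂ) = 0 := by rw [← ht, h0, zero_div]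
    exact_mod_cast h
  obtain ⟨-, -, -, hsha⟩ := shaAn_eq_of_L_one_div_eq hGZK W hL1 ht
  have hvq := padicValRat_shaAn_eq_sub_tamagawa hGZK hnf hMz hX hp5 hsha ht
  have hdep : ((pDepthAtP W p : ℕ) : ℤ) ≤ padicValRat p t :=
    pDepthAtP_le_padicValRat_of_muExceptionalAt hGS hMz hX hp5 hsp hw hμ ht ht0
  refine hX.missingUpperBoundAt_of_noPTorsion hGZK hsha ?_ hSha
  rw [hvq]
  have hdepth' : (padicValNat p W.tamagawaProduct : ℤ) ≤ pDepthAtP W p := by exact_mod_cast hdepth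
  linarith

section Branches

variable {W : WeierstrassCurve ℚ} [W.IsElliptic] [W.IsGloballyMinimal] {p : ℕ} [Fact p.Prime]

/-- **THE OTHER BRANCH (real proof = the tree's μ-door BY NAME): off the μ-exceptional branch `ord_p #Ш ≤ ord_p #Ш_an` at the pair**, modulo the nine facts
and GS at the (odd) prime — `¬ MuExceptionalAt` is literally the certificate binder `hcert` of `ClassX11a.missingUpperBoundAt_of_not_surj_of_hardCert_of_nineFacts`
(unit coefficient ⟹ `μ(X(E/ℚ_∞)) = 0` ⟹ Kato's divisibility integral at the pair ⟹ the rank-`0` engine). [cite: Kato2004Asterisque, Thm. 12.4 (p. 221) and §17.13 (pp. 279–280)]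
[cite: SteinWuthrich2013, Thm. 6.1 (p. 20)] [cite: Mazur1978, Cor. 4.1] [cite: Kobayashi2006DocMath, Cor. 4.2 (p. 575)] -/
theorem missingUpperBoundAt_of_not_muExceptionalAt
    (hJs : Literature.NumberTheory.EllipticCurves.SteinWuthrich2013.thm61_splitMultiplicative)
    (hJn : Literature.NumberTheory.EllipticCurves.SteinWuthrich2013.thm61_nonsplitMultiplicative)
    (h12 : Literature.NumberTheory.EllipticCurves.Kato2004.thm12_4) (hnf : exists_isNewformOf)
    (hns' : Literature.NumberTheory.EllipticCurves.Kato2004.exists_multDivisibilityInputs_nonsplit_contra)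
    (hsp' : Literature.NumberTheory.EllipticCurves.Kato2004.exists_multDivisibilityInputs_split_contra)
    (hfine' : Literature.NumberTheory.EllipticCurves.Kato2004.exists_multDivisibilityInputs_fine_contra)
    (hMz : mazur_not_dvd_maninConstant_of_odd) (hGS : GSOdd)
    (hX : ClassX11a W p) (hns : ¬ Surj W p) (hμ : ¬ MuExceptionalAt W p) : MissingUpperBoundAt W p :=
  Rank1Residual.ClassX11a.missingUpperBoundAt_of_not_surj_of_hardCert_of_nineFacts hJs hJn h12 hnf hns' hsp' hfine' hMz W p
    (fun _ => hGS W p hX.ne_two) hX hns (fun _ N hN f hf ϖ hϖ a L hsa hna hL => by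
      by_contra h
      push Not at h
      exact hμ ⟨N, hN, f, hf, ϖ, hϖ, a, L, hsa, hna, hL, h⟩)

end Branches

/-! ## §5b THE CLASS-WIDE VALUATION THEOREM AT MINIMAL TATE DEPTH (REV 2; inhabited by 20 named census pairs, sharp at 6480d1) -/

/-- **`ord_p (L(E,1)/Ω_E) ≥ v_p(c_p)` at minimal Tate depth, class-wide, BOTH BRANCHES (real proof; CONDITIONAL on the prints).**  For minimal `E/ℚ` in
X11a with `ρ̄_{E,p}` not onto, `5 ≤ p`, `p` split multiplicative, `w = ord_p log_p q_E = 2`, and `L(E,1)/Ω_E = t`:  `v_p(v_p(Δ_min)) ≤ ord_p t` — NO `Ш`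
hypothesis, NO Tamagawa hypothesis.  μ-exceptional branch: `pDepthAtP_le_padicValRat_of_muExceptionalAt` (the budget).  Certificate branch: the μ-door gives
`ord_p #Ш ≤ ord_p #Ш_an` (`missingUpperBoundAt_of_not_muExceptionalAt`), and `ord_p #Ш_an = ord_p t − ord_p ∏c` (`padicValRat_shaAn_eq_sub_tamagawa`) with
`0 ≤ ord_p #Ш` and `v_p(c_p) ≤ ord_p ∏c` (`pDepthAtP_le_padicValNat_tamagawaProduct_of_split`).  INHABITED: REF g24 ENGINE R job:j327971, the 20 split
census pairs with `w₅ = 2` (header); SHARP at 6480d1 (record: `c₅ = 5`, `∏c = 5`, `L/Ω = 5`, `#Ш_an = 1`; `ord₅(L/Ω) = 1 = v₅(c₅)`).  [cite: Kobayashi2006DocMath, Cor. 4.2 (p. 575)]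
[cite: Kato2004Asterisque, Thm. 12.4 (p. 221) and §17.13 (pp. 279–280)] [cite: SilvermanATAEC1994, Cor. IV.9.2 (d)] [cite: Miller2011LMS, Def. 1.1 (arXiv:1010.2431 p. 3)] -/
theorem pDepthAtP_le_padicValRat_LOne_div_of_minimalDepth (hP : PrintFacts) :
    ∀ (W : WeierstrassCurve ℚ) [W.IsElliptic] [W.IsGloballyMinimal] (p : ℕ) [Fact p.Prime],
      ClassX11a W p → ¬ Surj W p → 5 ≤ p → W.HasSplitMultiplicativeReductionAtPrime p → LogTateDepthTwo W p →
      ∀ t : ℚ, W.entireLFunction 1 / (W.realPeriodRat : ℂ) = (t : ℂ) → ((pDepthAtP W p : ℕ) : ℤ) ≤ padicValRat p t := by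
  obtain ⟨⟨hJs, hJn, h12, hnf, hns', hsp', hfine', hMz, hGZK, -, -, -, -⟩, hGS⟩ := hP
  intro W _ _ p _ hX hns hp5 hsp hw t ht
  -- `t ≠ 0`: analytic rank `0` (modularity + Mazur)
  obtain ⟨t', ht', ht0', -⟩ := hX.exists_LOne_div_realPeriod_eq_of_mazur hnf hMz hp5
  have htt : t = t' := by exact_mod_cast ht.symm.trans ht'
  subst htt
  by_cases hμ : MuExceptionalAt W p
  · exact pDepthAtP_le_padicValRat_of_muExceptionalAt hGS hMz hX hp5 hsp hw hμ ht ht0'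
  · obtain ⟨q, hq, hle⟩ := missingUpperBoundAt_of_not_muExceptionalAt hJs hJn h12 hnf hns' hsp' hfine' hMz hGS hX hns hμ
    have hvq := padicValRat_shaAn_eq_sub_tamagawa hGZK hnf hMz hX hp5 hq ht
    have hd : ((pDepthAtP W p : ℕ) : ℤ) ≤ (padicValNat p W.tamagawaProduct : ℤ) := by
      exact_mod_cast pDepthAtP_le_padicValNat_tamagawaProduct_of_split W hsp
    have h0 : (0 : ℤ) ≤ (padicValNat p W.shaOrder : ℤ) := by positivity
    linarith

/-- **THE CEILING, class-wide (real proof; CONDITIONAL on the prints): `v_p(c_p) + 2 ≤ ord_p (L(E,1)/Ω_E) + w` at EVERY Tate depth `w = ord_p log_p q_E`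
(`log_p q_E ≠ 0`) of a U5 pair with `p` split** — μ-branch: `depth_budget_of_muExceptionalAt`; certificate branch: `ord_p(L/Ω) ≥ ord_p ∏c ≥ v_p(c_p)` and `w ≥ 2`
(`two_le_valuation_padicLog_q`).  INHABITED by all 23 split census pairs of U5 at `p = 5` (REF j327971: `w₅ = 2` at 20, `w₅ = 3` at 59040b1, 59040c1, 118080ds1 —
there it reads `ord₅(L/Ω) ≥ v₅(c₅) − 1`, the honest shortfall).  At `w = 2` it is `pDepthAtP_le_padicValRat_LOne_div_of_minimalDepth`.
[cite: Kobayashi2006DocMath, Cor. 4.2 (p. 575)] [cite: Kato2004Asterisque, §17.13 (pp. 279–280)] [cite: SilvermanATAEC1994, Cor. IV.9.2 (d)] -/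
theorem depth_budget_classwide (hP : PrintFacts) :
    ∀ (W : WeierstrassCurve ℚ) [W.IsElliptic] [W.IsGloballyMinimal] (p : ℕ) [Fact p.Prime],
      ClassX11a W p → ¬ Surj W p → 5 ≤ p → W.HasSplitMultiplicativeReductionAtPrime p →
      ∀ D : TateParameterData W p, padicLog p D.q ≠ 0 →
      ∀ t : ℚ, W.entireLFunction 1 / (W.realPeriodRat : ℂ) = (t : ℂ) →
        ((pDepthAtP W p + 2 : ℕ) : ℤ) ≤ padicValRat p t + (padicLog p D.q).valuation := by
  obtain ⟨⟨hJs, hJn, h12, hnf, hns', hsp', hfine', hMz, hGZK, -, -, -, -⟩, hGS⟩ := hP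
  intro W _ _ p _ hX hns hp5 hsp D h0 t ht
  have hv2 : 2 ≤ (padicLog p D.q).valuation := two_le_valuation_padicLog_q hX.ne_two hX.mult hX.irr hns D h0
  obtain ⟨w, hw⟩ : ∃ w : ℕ, (padicLog p D.q).valuation = w := Int.eq_ofNat_of_zero_le (by omega)
  obtain ⟨t', ht', ht0', -⟩ := hX.exists_LOne_div_realPeriod_eq_of_mazur hnf hMz hp5
  have htt : t = t' := by exact_mod_cast ht.symm.trans ht'
  subst htt
  by_cases hμ : MuExceptionalAt W p
  · have hw0 : w ≠ 0 := by
      rintro rfl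
      rw [hw] at hv2
      norm_num at hv2
    rw [hw]
    exact depth_budget_of_muExceptionalAt hGS hMz hX hp5 hsp D hw0 hw hμ ht ht0'
  · obtain ⟨q, hq, hle⟩ := missingUpperBoundAt_of_not_muExceptionalAt hJs hJn h12 hnf hns' hsp' hfine' hMz hGS hX hns hμ
    have hvq := padicValRat_shaAn_eq_sub_tamagawa hGZK hnf hMz hX hp5 hq ht
    have hd : ((pDepthAtP W p : ℕ) : ℤ) ≤ (padicValNat p W.tamagawaProduct : ℤ) := by
      exact_mod_cast pDepthAtP_le_padicValNat_tamagawaProduct_of_split W hsp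
    have hsha0 : (0 : ℤ) ≤ (padicValNat p W.shaOrder : ℤ) := by positivity
    simp only [Nat.cast_add, Nat.cast_ofNat]
    linarith

/-- **SECTOR A″ CLASS-WIDE, BOTH BRANCHES (real proof; CONDITIONAL on the prints):** at «X11a, `¬ Surj`, `5 ≤ p`, `p` split, w = 2, `ord_p ∏c ≤ v_p(c_p)`, `Ш(E)[p] = 0`»
either branch closes — the μ-door off the exceptional branch, THE BUDGET on it.  New beyond the record on the stratum `p² ∣ c_p` (T1@p).
[cite: Kobayashi2006DocMath, Cor. 4.2 (p. 575)] [cite: Kato2004Asterisque, §17.13 (pp. 279–280)] [cite: Miller2011LMS, Def. 1.1] -/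
theorem minimalDepthSector_of (hP : PrintFacts) :
    ∀ (W : WeierstrassCurve ℚ) [W.IsElliptic] [W.IsGloballyMinimal] (p : ℕ) [Fact p.Prime],
      ClassX11a W p → ¬ Surj W p → 5 ≤ p → W.HasSplitMultiplicativeReductionAtPrime p →
      LogTateDepthTwo W p → padicValNat p W.tamagawaProduct ≤ pDepthAtP W p →
      (∀ x : W.sha, (p : ℤ) • x = 0 → x = 0) → MissingUpperBoundAt W p := by
  have hP' : PrintFacts := hP
  obtain ⟨⟨-, -, -, hnf, -, -, -, hMz, hGZK, -, -, -, -⟩, -⟩ := hP'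
  intro W _ _ p _ hX hns hp5 hsp hw hdepth hSha
  obtain ⟨t, ht, ht0, -⟩ := hX.exists_LOne_div_realPeriod_eq_of_mazur hnf hMz hp5
  have hL1 : W.entireLFunction 1 ≠ 0 := by
    intro h0
    apply ht0
    have h : ((t : ℚ) : ℂ) = 0 := by rw [← ht, h0, zero_div]
    exact_mod_cast h
  obtain ⟨-, -, -, hsha⟩ := shaAn_eq_of_L_one_div_eq hGZK W hL1 ht
  have hvq := padicValRat_shaAn_eq_sub_tamagawa hGZK hnf hMz hX hp5 hsha ht
  have hdep : ((pDepthAtP W p : ℕ) : ℤ) ≤ padicValRat p t :=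
    pDepthAtP_le_padicValRat_LOne_div_of_minimalDepth hP W p hX hns hp5 hsp hw t ht
  refine hX.missingUpperBoundAt_of_noPTorsion hGZK hsha ?_ hSha
  rw [hvq]
  have hdepth' : (padicValNat p W.tamagawaProduct : ℤ) ≤ pDepthAtP W p := by exact_mod_cast hdepth
  linarith

/-- **The record's C_Ш from C_Ш^exc (real proof):** dichotomy on `MuExceptionalAt`; off the branch the μ-door. [cite: Kato2004Asterisque, §17.13 (pp. 279–280)]
[cite: GreenbergLNM1716, §1 Conj. 1.11 (p. 62)] -/
theorem shaExponentCore_of (hP : PrintFacts) (hR : ShaExponentCoreMuExc) :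
    ∀ (W : WeierstrassCurve ℚ) [W.IsElliptic] [W.IsGloballyMinimal] (p : ℕ) [Fact p.Prime],
      ClassX11a W p → ¬ Surj W p → 5 ≤ p → (∃ x : W.sha, (p : ℤ) • x = 0 ∧ x ≠ 0) → MissingUpperBoundAt W p := by
  obtain ⟨⟨hJs, hJn, h12, hnf, hns', hsp', hfine', hMz, -, -, -, -, -⟩, hGS⟩ := hP
  intro W _ _ p _ hX hns hp5 hSha
  by_cases hμ : MuExceptionalAt W p
  · exact hR W p hX hns hp5 hSha hμ
  · exact missingUpperBoundAt_of_not_muExceptionalAt hJs hJn h12 hnf hns' hsp' hfine' hMz hGS hX hns hμ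

/-- **The record's C_cc from (C_cc ∖ A″)^exc and sector A″ (real proof):** dichotomy on `MuExceptionalAt`, then on A″. [cite: Kato2004Asterisque, §17.13 (pp. 279–280)]
[cite: Kobayashi2006DocMath, Cor. 4.2 (p. 575)] [cite: GreenbergLNM1716, §1 Conj. 1.11 (p. 62)] -/
theorem tamagawaDepthCore_of (hP : PrintFacts) (hR : TamagawaDepthCoreMuExc) :
    ∀ (W : WeierstrassCurve ℚ) [W.IsElliptic] [W.IsGloballyMinimal] (p : ℕ) [Fact p.Prime],
      ClassX11a W p → ¬ Surj W p → 5 ≤ p → 2 ≤ padicValNat p W.tamagawaProduct →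
      (∀ x : W.sha, (p : ℤ) • x = 0 → x = 0) → MissingUpperBoundAt W p := by
  obtain ⟨⟨hJs, hJn, h12, hnf, hns', hsp', hfine', hMz, hGZK, -, -, -, -⟩, hGS⟩ := hP
  intro W _ _ p _ hX hns hp5 htam hSha
  by_cases hμ : MuExceptionalAt W p
  · by_cases hA : W.HasSplitMultiplicativeReductionAtPrime p ∧ LogTateDepthTwo W p ∧
        padicValNat p W.tamagawaProduct ≤ pDepthAtP W p
    · exact muExcMinimalDepthSector_of hGS hnf hMz hGZK W p hX hns hp5 hA.1 hA.2.1 hA.2.2 hSha hμ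
    · exact hR W p hX hns hp5 htam hSha hμ hA
  · exact missingUpperBoundAt_of_not_muExceptionalAt hJs hJn h12 hnf hns' hsp' hfine' hMz hGS hX hns hμ

/-- **U5 ⟹ the two restricted stubs (trivial restriction; the cut asks NO MORE of the future than U5).** [cite: Miller2011LMS, Def. 1.1] -/
theorem parts_of_upperNonSurjFive (h : Theses.PrintX11a.UpperNonSurjFive) : ShaExponentCoreMuExc ∧ TamagawaDepthCoreMuExc :=
  ⟨fun W _ _ p _ hX hns hp5 _ _ => h W p hX hns hp5, fun W _ _ p _ hX hns hp5 _ _ _ _ => h W p hX hns hp5⟩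

/-- **U5 from the three statements (real proof):** the record's turnkey `GL1Cartan.upperNonSurjFive_of_elevenFacts_of_twoCores` (p691730) fed with C_Ш and C_cc
obtained from the restricted stubs by the μ-dichotomy.  CONDITIONAL on every displayed hypothesis. [cite: Kato2004Asterisque, §17.13 (pp. 279–280)] [cite: Miller2011LMS, Def. 1.1] -/
theorem UpperNonSurjFive_of_hyps (hP : PrintFacts) (hR₁ : ShaExponentCoreMuExc) (hR₂ : TamagawaDepthCoreMuExc) :
    Theses.PrintX11a.UpperNonSurjFive := by
  have hP' : PrintFacts := hP
  obtain ⟨⟨hJs, hJn, h12, hnf, hns', hsp', hfine', hMz, hGZK, hCE, hGV, hI, hLL⟩, -⟩ := hP'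
  exact upperNonSurjFive_of_elevenFacts_of_twoCores hJs hJn h12 hnf hns' hsp' hfine' hMz hGZK hCE hGV hI hLL
    (shaExponentCore_of hP hR₁) (tamagawaDepthCore_of hP hR₂)

/-- **Composition U5 — the crux BY NAME, stub-fed (real proof; `sorry` only inside the three stubs).** [cite: Miller2011LMS, Def. 1.1] -/
theorem UpperNonSurjFive_of_mudichot : Theses.PrintX11a.UpperNonSurjFive :=
  UpperNonSurjFive_of_hyps stub_printFacts stub_shaExponentCoreMuExc stub_tamagawaDepthCoreMuExc

end Summit.BirchSwinnertonDyer.BirchSwinnertonDyer.Cruxes.UpperNonSurjFive.MuDichot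

end
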